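import Summits.QuantumFields.BalabanUV.Beta.D1BFx.LogDetSecondVariation

/-!
# `BalabanUV.Beta.FP.InducedPolarizationLSector` — road «FP» for binder row D1, row **RHOA-2 (L-sector (iii), jet level)** of `RHOA-DESIGN.md` v1.1:
# the one-loop expansion of the COARSE GRAM DETERMINANT `½·δ² log det L_C`, `L_C = d^{cT}·G_C·d^c`, along a two-jet of the coarse legs
# `G_C = C⁻¹` (inverse jets `Ġ = −GĊG`, `G̈ = 2GĊGĊG − GC̈G`) and of the coarse vertex `d^c` (`ḋ^c`, `d̈^c`), displayed in the legs
# `L_C⁻¹`, `G_C` and `Ξ := G_C·d^c·L_C⁻¹·d^{cT}·G_C` — «the same list with one or both `G_C` replaced by `Ξ`, plus the coarse-vertex terms»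

HONEST DEPENDENCY (cell records, verbatim): «continuum YM on T⁴ ⇐ BetaPertH ∧ nine spine estimates (0/9 proved); BetaPertH ⇐ (D1) ∧ (D4) ∧
CAP+tail; G-an2-4 gates asym, D1 and NE2/3/4.»  HONEST FRAMING (cell contract, verbatim): «discharging `BetaPertH` makes Bałaban's UV stability
UNCONDITIONAL — a real constructive-QFT result; it is NOT the continuum limit and NOT the Clay problem.»  THIS MODULE is [folklore] matrix algebra
(Mathlib traces, transposes, inverses) over ABSTRACT matrices `G, C₁, C₂ : μ × μ`, `d, d₁, d₂ : μ × κ`; NO estimate, NO lattice object, nothing of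
Bałaban's manuscripts, no definition, no `def … : Prop`, nothing cited, 0 sorry.  It discharges NOTHING of `hbook`∕`hasym`∕D1.  NOT D1, NOT BetaPertH,
NOT continuum, NOT Clay.

ABSOLUTE RULE (cell charter, verbatim): «No internally-minted statement may enter as a cited fact. Every hypothesis is either kernel-proved in this
package or a verbatim quotation of a PUBLISHED theorem with page reference. The manuscript(s) under audit are NOT citable for their own disputed
steps — they are the thing under adjudication; programme-internal (2001/route/tribunal) claims are never citable.»

WHERE THIS SITS (`HOME/b2b-balaban-beta-d1-p3/RHOA-DESIGN.md` §0, §2 (iii)).  `K̃_n := δ²_V[½ log|det C_n| + ½ log det L_C]`; the C-sector (i)–(ii) is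
`FP/InducedPolarizationLoops.secondVar_blockProp_jets`; THIS FILE is the L-sector (iii): with the coarse leg `G` (symmetric; on the road `G = C_n⁻¹`),
its jets `G₁ = −G·C₁·G`, `G₂ = 2•G·C₁·G·C₁·G − G·C₂·G` (the inverse jets of the C-jets `C₁`, `C₂` of `InducedPolarizationLoops`), the coarse vertex
`d` with jets `d₁`, `d₂`, the Gram `L = dᵀ·G·d`, `Λ = L⁻¹`, and the DISPLAYED product-rule jets
`L₁ = d₁ᵀGd + dᵀGd₁ + dᵀG₁d`, `L₂ = d₂ᵀGd + dᵀGd₂ + 2•d₁ᵀGd₁ + 2•d₁ᵀG₁d + 2•dᵀG₁d₁ + dᵀG₂d`,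
the one-loop functional `secondVar L L₁ L₂ = tr(ΛL₂) − tr(ΛL₁ΛL₁)` equals
`[−tr(Ξ·C₂) + 2tr(Ξ·C₁·G·C₁) − tr(Ξ·C₁·Ξ·C₁)]` (the C-jet loops of the C-sector with one or both legs `G` replaced by `Ξ = G·d·Λ·dᵀ·G`)
`+ [2tr(Λ·dᵀGd₂) + 2tr(Λ·d₁ᵀGd₁) − 2tr(Λ·dᵀGd₁·Λ·dᵀGd₁) − 2tr(Λ·dᵀGd₁·Λ·d₁ᵀGd)]` (coarse-vertex tadpoles and bubbles, legs `Λ`, `G`)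
`+ [−4tr(Λ·dᵀGC₁Gd₁) + 4tr(Λ·dᵀGd₁·Λ·dᵀGC₁Gd)]` (one C-jet, one coarse vertex).

CONTENT (all [folklore]).
* §1 bookkeeping: symmetry of `L = dᵀGd`, of `Λ = L⁻¹`, of `Ξ`, of `V = dᵀG₁d`; the transpose of `U = dᵀGd₁`.
* §2 the TADPOLE `trace_inv_mul_gramJet₂` (`tr(Λ·L₂)` in the three legs) and the BUBBLE `trace_bubble_gramJet₁` (`tr(Λ·L₁·Λ·L₁)`, nine terms paired).
* §3 **`secondVar_gram_jets`** (the display above).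
NOT HERE: the curve form for the L-sector, the substitution of the Bałaban-object forms of `C₁`, `C₂` (compose with `InducedPolarizationLoops` at will),
tadpole-freeness (S4), any estimate (rows RHOA-6c∕6d).
Provenance: D1 formalisation swarm leaf seat `b2b-balaban-beta-d1-formalise-leaf-05` gen 11 (road «FP» row RHOA-2 (iii)), 2026-08-21.
-/

noncomputable section

namespace Summit.QuantumFields.BalabanUV.Beta.FP.InducedPolarizationLSector

open Matrix
open Summit.QuantumFields.BalabanUV.Beta.D1BFx.LogDetSecondVariation (secondVar)

variable {μ κ : Type*} [Fintype μ] [Fintype κ] [DecidableEq μ] [DecidableEq κ]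

/-! ## §1 Bookkeeping -/

omit [Fintype κ] [DecidableEq μ] [DecidableEq κ] in
/-- [folklore] The Gram `L = dᵀ·G·d` of a symmetric `G` is symmetric. -/
theorem gram_transpose {G : Matrix μ μ ℝ} (hG : Gᵀ = G) (d : Matrix μ κ ℝ) : (dᵀ * G * d)ᵀ = dᵀ * G * d := by
  rw [Matrix.transpose_mul, Matrix.transpose_mul, Matrix.transpose_transpose, hG, Matrix.mul_assoc]

omit [DecidableEq μ] in
/-- [folklore] `Λ = L⁻¹` is symmetric. -/
theorem inv_gram_transpose {G : Matrix μ μ ℝ} (hG : Gᵀ = G) (d : Matrix μ κ ℝ) : ((dᵀ * G * d)⁻¹)ᵀ = (dᵀ * G * d)⁻¹ := by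
  rw [Matrix.transpose_nonsing_inv, gram_transpose hG]

omit [DecidableEq μ] in
/-- [folklore] `Ξ = G·d·Λ·dᵀ·G` is symmetric. -/
theorem xi_transpose {G : Matrix μ μ ℝ} (hG : Gᵀ = G) (d : Matrix μ κ ℝ) :
    (G * d * (dᵀ * G * d)⁻¹ * dᵀ * G)ᵀ = G * d * (dᵀ * G * d)⁻¹ * dᵀ * G := by
  rw [Matrix.transpose_mul, Matrix.transpose_mul, Matrix.transpose_mul, Matrix.transpose_mul, inv_gram_transpose hG,
    Matrix.transpose_transpose, hG]
  simp only [Matrix.mul_assoc]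

omit [Fintype κ] [DecidableEq μ] [DecidableEq κ] in
/-- [folklore] `(dᵀ·G·d₁)ᵀ = d₁ᵀ·G·d` for symmetric `G`. -/
theorem transpose_gramJet {G : Matrix μ μ ℝ} (hG : Gᵀ = G) (d d₁ : Matrix μ κ ℝ) : (dᵀ * G * d₁)ᵀ = d₁ᵀ * G * d := by
  rw [Matrix.transpose_mul, Matrix.transpose_mul, Matrix.transpose_transpose, hG, Matrix.mul_assoc]

omit [Fintype κ] [DecidableEq μ] [DecidableEq κ] in
/-- [folklore] `dᵀ·(G·C₁·G)·d` is symmetric for symmetric `G`, `C₁`. -/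
theorem transpose_sandwich {G C₁ : Matrix μ μ ℝ} (hG : Gᵀ = G) (hC₁ : C₁ᵀ = C₁) (d : Matrix μ κ ℝ) :
    (dᵀ * (G * C₁ * G) * d)ᵀ = dᵀ * (G * C₁ * G) * d := by
  simp only [Matrix.transpose_mul, Matrix.transpose_transpose, hG, hC₁, Matrix.mul_assoc]

/-! ## §2 The tadpole and the bubble of the Gram jets -/

omit [DecidableEq μ] in
/-- [folklore] THE TADPOLE `tr(Λ·L₂)` of the displayed second Gram jet, in the legs `Λ`, `G`, `Ξ`:
`2tr(ΛdᵀGd₂) + 2tr(Λd₁ᵀGd₁) − 4tr(ΛdᵀGC₁Gd₁) + 2tr(ΞC₁GC₁) − tr(ΞC₂)`. -/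
theorem trace_inv_mul_gramJet₂ {G C₁ : Matrix μ μ ℝ} (hG : Gᵀ = G) (hC₁ : C₁ᵀ = C₁) (C₂ : Matrix μ μ ℝ) (d d₁ d₂ : Matrix μ κ ℝ)
    (G₁ G₂ : Matrix μ μ ℝ) (hG₁ : G₁ = -(G * C₁ * G)) (hG₂ : G₂ = (2 : ℝ) • (G * C₁ * G * C₁ * G) - G * C₂ * G)
    (L₂ : Matrix κ κ ℝ)
    (hL₂ : L₂ = d₂ᵀ * G * d + dᵀ * G * d₂ + (2 : ℝ) • (d₁ᵀ * G * d₁) + (2 : ℝ) • (d₁ᵀ * G₁ * d) + (2 : ℝ) • (dᵀ * G₁ * d₁) + dᵀ * G₂ * d) :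
    ((dᵀ * G * d)⁻¹ * L₂).trace
      = 2 * ((dᵀ * G * d)⁻¹ * (dᵀ * G * d₂)).trace + 2 * ((dᵀ * G * d)⁻¹ * (d₁ᵀ * G * d₁)).trace
        - 4 * ((dᵀ * G * d)⁻¹ * (dᵀ * (G * C₁ * G) * d₁)).trace
        + 2 * (G * d * (dᵀ * G * d)⁻¹ * dᵀ * G * C₁ * G * C₁).trace - (G * d * (dᵀ * G * d)⁻¹ * dᵀ * G * C₂).trace := by
  set Λ := (dᵀ * G * d)⁻¹ with hΛ
  have hΛt : Λᵀ = Λ := by rw [hΛ]; exact inv_gram_transpose hG d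
  -- twins by transposition
  have t1 : (Λ * (d₂ᵀ * G * d)).trace = (Λ * (dᵀ * G * d₂)).trace := by
    rw [← Matrix.trace_transpose (Λ * (d₂ᵀ * G * d)), Matrix.transpose_mul, transpose_gramJet hG d₂ d, hΛt,
      Matrix.trace_mul_comm (dᵀ * G * d₂) Λ]
  have t2 : (Λ * (d₁ᵀ * G₁ * d)).trace = -((Λ * (dᵀ * (G * C₁ * G) * d₁)).trace) := by
    rw [hG₁]
    simp only [Matrix.mul_neg, Matrix.neg_mul, Matrix.trace_neg, neg_inj]
    rw [← Matrix.trace_transpose (Λ * (d₁ᵀ * (G * C₁ * G) * d)), Matrix.transpose_mul, hΛt,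
      show (d₁ᵀ * (G * C₁ * G) * d)ᵀ = dᵀ * (G * C₁ * G) * d₁ by
        simp only [Matrix.transpose_mul, Matrix.transpose_transpose, hG, hC₁, Matrix.mul_assoc],
      Matrix.trace_mul_comm (dᵀ * (G * C₁ * G) * d₁) Λ]
  have t3 : (Λ * (dᵀ * G₁ * d₁)).trace = -((Λ * (dᵀ * (G * C₁ * G) * d₁)).trace) := by
    rw [hG₁]
    simp only [Matrix.mul_neg, Matrix.neg_mul, Matrix.trace_neg]
  have t4 : (Λ * (dᵀ * G₂ * d)).trace
      = 2 * (G * d * Λ * dᵀ * G * C₁ * G * C₁).trace - (G * d * Λ * dᵀ * G * C₂).trace := by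
    -- `tr(Λ·dᵀ·X·d) = tr(d·Λ·dᵀ·X)` and then `G` to the front
    have rot : ∀ X : Matrix μ μ ℝ, (Λ * (dᵀ * (G * X * G) * d)).trace = (G * d * Λ * dᵀ * G * X).trace := by
      intro X
      rw [show Λ * (dᵀ * (G * X * G) * d) = (Λ * dᵀ * G * X) * (G * d) by simp only [Matrix.mul_assoc],
        Matrix.trace_mul_comm]
      simp only [Matrix.mul_assoc]
    rw [hG₂, show G * C₁ * G * C₁ * G = G * (C₁ * G * C₁) * G by simp only [Matrix.mul_assoc]]
    simp only [Matrix.mul_sub, Matrix.sub_mul, Matrix.mul_smul, Matrix.smul_mul, Matrix.trace_sub, Matrix.trace_smul, smul_eq_mul]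
    rw [rot, rot]
    simp only [Matrix.mul_assoc]
  rw [hL₂]
  simp only [Matrix.mul_add, Matrix.mul_smul, Matrix.trace_add, Matrix.trace_smul, smul_eq_mul]
  rw [t1, t2, t3, t4]
  ring

omit [DecidableEq μ] in
/-- [folklore] THE BUBBLE `tr(Λ·L₁·Λ·L₁)` of the displayed first Gram jet `L₁ = d₁ᵀGd + dᵀGd₁ + dᵀG₁d` (`G₁ = −GC₁G`): with `U = dᵀGd₁`,
`V = −dᵀGC₁Gd`, the nine terms pair up to `2tr(ΛUΛU) + 2tr(ΛUΛUᵀ) + 4tr(ΛUΛV) + tr(ΛVΛV)`, i.e.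
`2tr(ΛdᵀGd₁ΛdᵀGd₁) + 2tr(ΛdᵀGd₁Λd₁ᵀGd) − 4tr(ΛdᵀGd₁ΛdᵀGC₁Gd) + tr(ΞC₁ΞC₁)`. -/
theorem trace_bubble_gramJet₁ {G C₁ : Matrix μ μ ℝ} (hG : Gᵀ = G) (hC₁ : C₁ᵀ = C₁) (d d₁ : Matrix μ κ ℝ)
    (G₁ : Matrix μ μ ℝ) (hG₁ : G₁ = -(G * C₁ * G)) (L₁ : Matrix κ κ ℝ) (hL₁ : L₁ = d₁ᵀ * G * d + dᵀ * G * d₁ + dᵀ * G₁ * d) :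
    ((dᵀ * G * d)⁻¹ * L₁ * ((dᵀ * G * d)⁻¹ * L₁)).trace
      = 2 * ((dᵀ * G * d)⁻¹ * (dᵀ * G * d₁) * ((dᵀ * G * d)⁻¹ * (dᵀ * G * d₁))).trace
        + 2 * ((dᵀ * G * d)⁻¹ * (dᵀ * G * d₁) * ((dᵀ * G * d)⁻¹ * (d₁ᵀ * G * d))).trace
        - 4 * ((dᵀ * G * d)⁻¹ * (dᵀ * G * d₁) * ((dᵀ * G * d)⁻¹ * (dᵀ * (G * C₁ * G) * d))).trace
        + (G * d * (dᵀ * G * d)⁻¹ * dᵀ * G * C₁ * (G * d * (dᵀ * G * d)⁻¹ * dᵀ * G * C₁)).trace := by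
  set Λ := (dᵀ * G * d)⁻¹ with hΛ
  set U : Matrix κ κ ℝ := dᵀ * G * d₁ with hU
  set W : Matrix κ κ ℝ := dᵀ * (G * C₁ * G) * d with hW
  have hΛt : Λᵀ = Λ := by rw [hΛ]; exact inv_gram_transpose hG d
  have hUt : Uᵀ = d₁ᵀ * G * d := by rw [hU]; exact transpose_gramJet hG d d₁
  have hU't : (d₁ᵀ * G * d)ᵀ = U := by rw [← hUt, Matrix.transpose_transpose]
  have hWt : Wᵀ = W := by rw [hW]; exact transpose_sandwich hG hC₁ d
  have hV : dᵀ * G₁ * d = -W := by rw [hG₁, hW, Matrix.mul_neg, Matrix.neg_mul]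
  -- transposition and cyclic twins
  have twin : ∀ X Y : Matrix κ κ ℝ, (Λ * X * (Λ * Y)).trace = (Λ * Yᵀ * (Λ * Xᵀ)).trace := by
    intro X Y
    rw [← Matrix.trace_transpose (Λ * X * (Λ * Y)), Matrix.transpose_mul, Matrix.transpose_mul, Matrix.transpose_mul, hΛt,
      show Yᵀ * Λ * (Xᵀ * Λ) = Yᵀ * (Λ * Xᵀ) * Λ by simp only [Matrix.mul_assoc], Matrix.trace_mul_comm, ← Matrix.mul_assoc]
  have cyc : ∀ X Y : Matrix κ κ ℝ, (Λ * X * (Λ * Y)).trace = (Λ * Y * (Λ * X)).trace := fun X Y => Matrix.trace_mul_comm _ _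
  -- the `ΛWΛW` monomial in `Ξ`-legs
  have mWW : (Λ * W * (Λ * W)).trace = (G * d * Λ * dᵀ * G * C₁ * (G * d * Λ * dᵀ * G * C₁)).trace := by
    rw [hW, show Λ * (dᵀ * (G * C₁ * G) * d) * (Λ * (dᵀ * (G * C₁ * G) * d))
        = (Λ * dᵀ * G * C₁ * (G * d * Λ * dᵀ * G * C₁)) * (G * d) by simp only [Matrix.mul_assoc], Matrix.trace_mul_comm]
    simp only [Matrix.mul_assoc]
  rw [hL₁, hV]
  simp only [Matrix.mul_add, Matrix.add_mul, Matrix.mul_neg, Matrix.neg_mul, Matrix.trace_add, Matrix.trace_neg, sub_eq_add_neg]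
  rw [twin (d₁ᵀ * G * d) (d₁ᵀ * G * d), hU't, cyc (d₁ᵀ * G * d) U, cyc W U, cyc W (d₁ᵀ * G * d), twin (d₁ᵀ * G * d) W, hWt, hU't,
    cyc W U, mWW]
  ring

/-! ## §3 Row RHOA-2, L-sector: the coarse Gram loops -/

omit [DecidableEq μ] in
/-- [folklore] **ROW RHOA-2, L-SECTOR (iii): THE COARSE GRAM LOOPS.**  For a symmetric coarse leg `G` with inverse-type jets `G₁ = −G·C₁·G`,
`G₂ = 2•G·C₁·G·C₁·G − G·C₂·G` (`C₁` symmetric), a coarse vertex `d` with jets `d₁`, `d₂`, and the displayed product-rule jets `L₁`, `L₂` of the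
Gram `L = dᵀ·G·d`, the one-loop functional `secondVar L L₁ L₂ = tr(L⁻¹L₂) − tr(L⁻¹L₁L⁻¹L₁)` equals
`−tr(ΞC₂) + 2tr(ΞC₁GC₁) − tr(ΞC₁ΞC₁)` (the C-jet loops with one or both legs `Ξ = G·d·L⁻¹·dᵀ·G`)
`+ 2tr(L⁻¹dᵀGd₂) + 2tr(L⁻¹d₁ᵀGd₁) − 2tr(L⁻¹dᵀGd₁L⁻¹dᵀGd₁) − 2tr(L⁻¹dᵀGd₁L⁻¹d₁ᵀGd)` (coarse-vertex loops)
`− 4tr(L⁻¹dᵀGC₁Gd₁) + 4tr(L⁻¹dᵀGd₁L⁻¹dᵀGC₁Gd)` (mixed).  Formal in `L⁻¹`: no invertibility hypothesis. -/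
theorem secondVar_gram_jets {G C₁ : Matrix μ μ ℝ} (hG : Gᵀ = G) (hC₁ : C₁ᵀ = C₁) (C₂ : Matrix μ μ ℝ) (d d₁ d₂ : Matrix μ κ ℝ)
    (G₁ G₂ : Matrix μ μ ℝ) (hG₁ : G₁ = -(G * C₁ * G)) (hG₂ : G₂ = (2 : ℝ) • (G * C₁ * G * C₁ * G) - G * C₂ * G)
    (L₁ L₂ : Matrix κ κ ℝ) (hL₁ : L₁ = d₁ᵀ * G * d + dᵀ * G * d₁ + dᵀ * G₁ * d)
    (hL₂ : L₂ = d₂ᵀ * G * d + dᵀ * G * d₂ + (2 : ℝ) • (d₁ᵀ * G * d₁) + (2 : ℝ) • (d₁ᵀ * G₁ * d) + (2 : ℝ) • (dᵀ * G₁ * d₁) + dᵀ * G₂ * d) :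
    secondVar (dᵀ * G * d) L₁ L₂
      = -(G * d * (dᵀ * G * d)⁻¹ * dᵀ * G * C₂).trace + 2 * (G * d * (dᵀ * G * d)⁻¹ * dᵀ * G * C₁ * G * C₁).trace
        - (G * d * (dᵀ * G * d)⁻¹ * dᵀ * G * C₁ * (G * d * (dᵀ * G * d)⁻¹ * dᵀ * G * C₁)).trace
        + 2 * ((dᵀ * G * d)⁻¹ * (dᵀ * G * d₂)).trace + 2 * ((dᵀ * G * d)⁻¹ * (d₁ᵀ * G * d₁)).trace
        - 2 * ((dᵀ * G * d)⁻¹ * (dᵀ * G * d₁) * ((dᵀ * G * d)⁻¹ * (dᵀ * G * d₁))).trace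
        - 2 * ((dᵀ * G * d)⁻¹ * (dᵀ * G * d₁) * ((dᵀ * G * d)⁻¹ * (d₁ᵀ * G * d))).trace
        - 4 * ((dᵀ * G * d)⁻¹ * (dᵀ * (G * C₁ * G) * d₁)).trace
        + 4 * ((dᵀ * G * d)⁻¹ * (dᵀ * G * d₁) * ((dᵀ * G * d)⁻¹ * (dᵀ * (G * C₁ * G) * d))).trace := by
  unfold secondVar
  rw [trace_inv_mul_gramJet₂ hG hC₁ C₂ d d₁ d₂ G₁ G₂ hG₁ hG₂ L₂ hL₂, trace_bubble_gramJet₁ hG hC₁ d d₁ G₁ hG₁ L₁ hL₁]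
  ring

end Summit.QuantumFields.BalabanUV.Beta.FP.InducedPolarizationLSector

end
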